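import Summits.QuantumFields.YangMills.Theorems.BalabanUVNodesN11TStepBranchSum

/-!
# DAG node N11 — GRAPH-PRODUCT INTEGRABILITY ⟹ A.E. CONDITIONAL INTEGRABILITY OF SECTIONS, GUARDED BY THE MARGINAL DENSITY (def-T's `kernelTransport` currency with
# an s-finite parameter), AT 11a's CARRIERS, and p619836's `hint` ROW IN GUARDED FORM: the branch-sum junction and the identity of (O3′) `_of_integrable_graph`

WHY.  dag-n11-d g15's branch-sum junction `…N11TStepBranchSum.tstepOfRecord_comp_glue_ae_eq_sum_genOp` (p619836) displays, besides `hG` ∕ `hin` ∕ `hinnerSum`, the row `hint`: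
for product-Haar-a.e. presented coarse field `q = (q.1, q.2)` every summand's explicit inside integrand `y ↦ ζ_i(ω_{y,q})·(aOp k sA_i w_i Φ_i)(ω_{y,q})` is integrable against
11a's restricted conditional law `condLaw (Π_{sV} Haar) (avgRestrOfRecord …) q.1`.  This file (hand-out X-w2a, dag-n11-d g15 I.34820) supplies that row FROM GRAPH-PRODUCT
INTEGRABILITY — integrability of `(y, z) ↦ f((avg y, z), y)` against `ν ⊗ μZ` — by disintegration, in the only form in which it is true: GUARDED by `margDensity … q.1 ≠ 0`
(off the support of `avg_* ν` the conditional law is arbitrary), equivalently UNGUARDED but `(avg_* ν) ⊗ μZ`-a.e. («everywhere the transport is read»).  The guard costs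
nothing downstream: both members of the branch-sum identity carry the factor `margDensity … q.1`, so §3–§4 re-run p619836's junction and its identity of (O3′) on the
nose with `hint` REPLACED by per-summand joint measurability + graph-product integrability.

WHAT THIS FILE PROVES (0 `sorry`, 0 `def`).  §1 GENERIC (ν finite on a standard Borel `β`, `avg : β → α` measurable, `ν.map avg ≪ μ`, `μ` σ-finite, any s-finite `μZ` on `Z`):
`lintegral_graph_eq_lintegral_margDensity_mul` (`∫⁻ g(avg y, y) dν = ∫⁻ h(v)·(∫⁻ g(v,y) condLaw(v,dy)) dμ(v)`), `ae_integrable_condLaw_of_integrable_graph` (no parameter — the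
generic twin of dag-n11-d's full-carrier `…TkNoExpansionSumTransportIntegrable.ae_integrable_section_of_integrable_graph`), ★ `ae_prod_integrable_condLaw_of_integrable_graph`
(`∀ᵐ q ∂(μ.prod μZ), margDensity ν μ avg q.1 ≠ 0 → Integrable (f (q, ·)) (condLaw ν avg q.1)` — Tonelli, the `ℝ≥0∞` disintegration, `ae_lt_top`),
★ `ae_map_prod_integrable_condLaw_of_integrable_graph` (the unguarded `(ν.map avg).prod μZ`-a.e. twin: `prod_withDensity_left`, `ae_withDensity_iff`).
§2 AT 11a's CARRIERS (`Π_{sV} Haar`, `avgRestrOfRecord F N K k sV sV'`, against `Π_{sV'} Haar`, parameter `μZ`): `kernelRTOfRecord_eq_zero_of_margDensity_eq_zero`,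
★★ `ae_prod_integrable_condLaw_avgRestrOfRecord_of_integrable_graph` (finite family, guarded), ★★ `kernelRTOfRecord_finset_sum_ae_of_integrable_graph` (A.E. ADDITIVITY of the
restricted transport of record from per-summand graph-product integrability).  §3 ★★★ `tstepOfRecord_comp_glue_ae_eq_sum_genOp_of_integrable_graph` — p619836 §2 with `hint`
REPLACED by `hgm` ∕ `hI` against `Π_{sV_k} Haar ⊗ Π_{sV'ᶜ} Haar` (`hac` of the restricted averaging of record = dag-n11-e's `map_pi_avgRestrOfRecord_absolutelyContinuous_Omega`
BY NAME).  §4 ★★★ `slotsTOfRecord_succ_ae_eq_TkOfRecord_succ_of_innerSum_of_integrable_graph` — p619836 §3's identity of (O3′) on the nose, same replacement.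
`hG` ∕ `hin` ∕ `hinnerSum` unchanged and still DISPLAYED throughout.

HONEST SCOPE.  Width seat dag-n11-w2 (g3) on dag-n11-d g15's hand-out X-w2a; helper lane of K1⁸ `stmt-QuantumFields-26907`, count-neutral.  [folklore] disintegration
bookkeeping (Tonelli, `Measure.condKernel`, `withDensity`) over def-T's `kernelTransport` ∕ `condLaw` ∕ `margDensity` and 11a's `kernelRTOfRecord`; nothing of p619836, p617211,
p616225 or 11a is re-typed (imported BY NAME); NO estimate of [Balaban1988Convergent] is asserted; no chart, no Jacobian, no gauge fixing; `hinnerSum` — where the mathematics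
of [I] §2 ∕ [III] §3 lives — is untouched.  N11 is NOT discharged; K1⁸ is NOT closed.  One finite four-torus programme at fixed `ε = L^{−K}`: NOT ℝ⁴, NOT OS, NOT a mass gap,
NOT Clay — R4 closes only the conditional finite-𝕋⁴ rung `BalabanLadder.UV`.
-/

noncomputable section

open MeasureTheory ProbabilityTheory
open scoped ENNReal NNReal BigOperators

namespace Summit.QuantumFields.YangMills.Theorems.BalabanUVNodesN11KernelRTSectionIntegrable

open Literature.MathematicalPhysics.QuantumFieldTheory.Balaban1983to89
open Literature.MathematicalPhysics.QuantumFieldTheory.Balaban1983to89.T4AveragingDisintegration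
open BalabanUVNodesN11TStepOfRecordSeparated (tstepOfRecord_comp_glue_ae_eq_kernelRTOfRecord_bondsIn)
open BalabanUVNodesN11TStepGenOpJunction (kernelRTOfRecord_congr_of_fibre_ae_prod)
open BalabanUVNodesN11AveragingSkewPresentationAtRecord (toFine_mem_compl_Omega_iff map_pi_avgRestrOfRecord_absolutelyContinuous_Omega)
open BalabanUVNodesN11TStepBranchSum (kernelRTOfRecord_finset_sum_apply genOp_genDataOfRecord_eq_kernelRTOfRecord_of_pinned baseCfg_succ_comp_glue_pinned
  TkOfRecord_succ_eq_sum_genOp ae_eq_of_comp_glue_ae_eq)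
open Node00 hiding SU
open Node00.Tk T4Continuum
open B10Eq42TorusConstraint (bondsIn)
open B10Eq38TorusDomains (toFine)

/-! ## §1  Generic: graph(-product) integrability ⟹ conditional integrability of sections, a.e. off the null set of the marginal density -/

section Generic

variable {α β : Type*} [MeasurableSpace α] [MeasurableSpace β] [StandardBorelSpace β] [Nonempty β]

/-- **THE `ℝ≥0∞` DISINTEGRATION ALONG THE GRAPH**: for measurable `g ≥ 0`, `∫⁻ g(avg y, y) dν(y) = ∫⁻ h(v) · (∫⁻ g(v, y) condLaw(v, dy)) dμ(v)` with `h` the marginal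
density (`jointLaw = (μ.withDensity h) ⊗ₘ condLaw`, `Measure.lintegral_compProd`, `lintegral_withDensity_eq_lintegral_mul`). [cite: Balaban1985Averaging, (10) p.19 (bookkeeping)] -/
theorem lintegral_graph_eq_lintegral_margDensity_mul (ν : Measure β) [IsFiniteMeasure ν] (μ : Measure α) [SigmaFinite μ]
    {avg : β → α} (havg : Measurable avg) (hac : ν.map avg ≪ μ) {g : α × β → ℝ≥0∞} (hg : Measurable g) :
    ∫⁻ y, g (avg y, y) ∂ν = ∫⁻ v, (margDensity ν μ avg v : ℝ≥0∞) * ∫⁻ y, g (v, y) ∂(condLaw ν avg v) ∂μ := by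
  have h1 : ∫⁻ y, g (avg y, y) ∂ν = ∫⁻ p, g p ∂(jointLaw ν avg) := by
    rw [jointLaw, lintegral_map hg (measurable_graphMap havg)]
  rw [h1, ← disintegration ν μ havg hac, Measure.lintegral_compProd hg,
    lintegral_withDensity_eq_lintegral_mul _ measurable_margDensity.coe_nnreal_ennreal
      (hg.lintegral_kernel_prod_right' (κ := condLaw ν avg))]
  rfl

/-- **GRAPH-INTEGRABLE ⟹ CONDITIONALLY INTEGRABLE SECTIONS, A.E. OFF THE NULL SET OF THE MARGINAL DENSITY** (no parameter; generic carriers): for `f : α × β → ℝ` jointly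
measurable with `y ↦ f(avg y, y)` ν-integrable, `μ`-a.e. `v` with `h(v) ≠ 0` has `f(v, ·)` integrable against `condLaw ν avg v` (Mathlib's `Integrable.condKernel_ae` on the joint
law, `withDensity_margDensity_eq_fst`, `ae_withDensity_iff`) — the generic twin of dag-n11-d's full-carrier `ae_integrable_section_of_integrable_graph`.
[cite: Balaban1985Averaging, (10) p.19 (bookkeeping)] -/
theorem ae_integrable_condLaw_of_integrable_graph (ν : Measure β) [IsFiniteMeasure ν] (μ : Measure α) [SigmaFinite μ]
    {avg : β → α} (havg : Measurable avg) (hac : ν.map avg ≪ μ) {f : α × β → ℝ} (hf : Measurable f)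
    (hI : Integrable (fun y => f (avg y, y)) ν) :
    ∀ᵐ v ∂μ, margDensity ν μ avg v ≠ 0 → Integrable (fun y => f (v, y)) (condLaw ν avg v) := by
  have hgi : Integrable f (jointLaw ν avg) := (integrable_jointLaw_iff ν havg hf.aestronglyMeasurable).2 hI
  have h1 : ∀ᵐ v ∂(jointLaw ν avg).fst, Integrable (fun y => f (v, y)) ((jointLaw ν avg).condKernel v) := hgi.condKernel_ae
  rw [← withDensity_margDensity_eq_fst ν μ havg hac, ae_withDensity_iff measurable_margDensity.coe_nnreal_ennreal] at h1
  filter_upwards [h1] with v hv hne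
  exact hv (by exact_mod_cast hne)

/-- ★ **GRAPH-PRODUCT-INTEGRABLE ⟹ CONDITIONALLY INTEGRABLE SECTIONS, `(μ ⊗ μZ)`-A.E. OFF THE NULL SET OF THE MARGINAL DENSITY** (WITH an s-finite parameter `(Z, μZ)`):
for `f : (α × Z) × β → ℝ` jointly measurable with `(y, z) ↦ f((avg y, z), y)` integrable against `ν ⊗ μZ`, for `(μ ⊗ μZ)`-a.e. `q = (v, z)` with `h(v) ≠ 0` the section
`f(q, ·)` is integrable against `condLaw ν avg v`.  Proof: Tonelli on `ν ⊗ μZ`, the `ℝ≥0∞` disintegration of `ν` along the graph, Tonelli inside and on `μ ⊗ μZ`, then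
`ae_lt_top` on `q ↦ h(q.1) · ∫⁻ ‖f(q, y)‖ₑ condLaw(q.1, dy)`. [cite: Balaban1985Averaging, (10) p.19 (bookkeeping)] -/
theorem ae_prod_integrable_condLaw_of_integrable_graph (ν : Measure β) [IsFiniteMeasure ν] (μ : Measure α) [SigmaFinite μ]
    {avg : β → α} (havg : Measurable avg) (hac : ν.map avg ≪ μ) {Z : Type*} [MeasurableSpace Z] (μZ : Measure Z) [SFinite μZ]
    {f : (α × Z) × β → ℝ} (hf : Measurable f) (hI : Integrable (fun p : β × Z => f ((avg p.1, p.2), p.1)) (ν.prod μZ)) :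
    ∀ᵐ q ∂(μ.prod μZ), margDensity ν μ avg q.1 ≠ 0 → Integrable (fun y => f (q, y)) (condLaw ν avg q.1) := by
  -- measurability of the integrands in play
  have hm1 : Measurable fun p : β × Z => ‖f ((avg p.1, p.2), p.1)‖ₑ :=
    (hf.comp (((havg.comp measurable_fst).prodMk measurable_snd).prodMk measurable_fst)).enorm
  have hm2 : Measurable fun p : α × β => ∫⁻ z, ‖f ((p.1, z), p.2)‖ₑ ∂μZ :=
    ((hf.comp (((measurable_fst.comp measurable_fst).prodMk measurable_snd).prodMk (measurable_snd.comp measurable_fst))).enorm).lintegral_prod_right'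
  have hG : Measurable fun q : α × Z => ∫⁻ y, ‖f (q, y)‖ₑ ∂(condLaw ν avg q.1) := by
    simpa only [Kernel.prodMkRight_apply] using (hf.enorm).lintegral_kernel_prod_right' (κ := Kernel.prodMkRight Z (condLaw ν avg))
  have hHG : Measurable fun q : α × Z => (margDensity ν μ avg q.1 : ℝ≥0∞) * ∫⁻ y, ‖f (q, y)‖ₑ ∂(condLaw ν avg q.1) :=
    (measurable_margDensity.coe_nnreal_ennreal.comp measurable_fst).mul hG
  -- the chain of Tonelli ∕ disintegration identities
  have e1 : ∫⁻ p, ‖f ((avg p.1, p.2), p.1)‖ₑ ∂(ν.prod μZ) = ∫⁻ y, ∫⁻ z, ‖f ((avg y, z), y)‖ₑ ∂μZ ∂ν :=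
    lintegral_prod _ hm1.aemeasurable
  have e2 : ∫⁻ y, ∫⁻ z, ‖f ((avg y, z), y)‖ₑ ∂μZ ∂ν =
      ∫⁻ v, (margDensity ν μ avg v : ℝ≥0∞) * ∫⁻ y, ∫⁻ z, ‖f ((v, z), y)‖ₑ ∂μZ ∂(condLaw ν avg v) ∂μ :=
    lintegral_graph_eq_lintegral_margDensity_mul ν μ havg hac (g := fun p : α × β => ∫⁻ z, ‖f ((p.1, z), p.2)‖ₑ ∂μZ) hm2
  have e3 : ∀ v, ∫⁻ y, ∫⁻ z, ‖f ((v, z), y)‖ₑ ∂μZ ∂(condLaw ν avg v) = ∫⁻ z, ∫⁻ y, ‖f ((v, z), y)‖ₑ ∂(condLaw ν avg v) ∂μZ := fun v =>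
    lintegral_lintegral_swap ((hf.comp ((measurable_const.prodMk measurable_snd).prodMk measurable_fst)).enorm).aemeasurable
  have hGv : ∀ v, Measurable fun z : Z => ∫⁻ y, ‖f ((v, z), y)‖ₑ ∂(condLaw ν avg v) := fun v =>
    hG.comp measurable_prodMk_left
  have e4 : ∫⁻ q, (margDensity ν μ avg q.1 : ℝ≥0∞) * ∫⁻ y, ‖f (q, y)‖ₑ ∂(condLaw ν avg q.1) ∂(μ.prod μZ) =
      ∫⁻ v, (margDensity ν μ avg v : ℝ≥0∞) * ∫⁻ z, ∫⁻ y, ‖f ((v, z), y)‖ₑ ∂(condLaw ν avg v) ∂μZ ∂μ := by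
    rw [lintegral_prod _ hHG.aemeasurable]; exact lintegral_congr fun v => lintegral_const_mul (margDensity ν μ avg v : ℝ≥0∞) (hGv v)
  have hfin : ∫⁻ q, (margDensity ν μ avg q.1 : ℝ≥0∞) * ∫⁻ y, ‖f (q, y)‖ₑ ∂(condLaw ν avg q.1) ∂(μ.prod μZ) ≠ ∞ := by
    have h : ∫⁻ q, (margDensity ν μ avg q.1 : ℝ≥0∞) * ∫⁻ y, ‖f (q, y)‖ₑ ∂(condLaw ν avg q.1) ∂(μ.prod μZ) =
        ∫⁻ p, ‖f ((avg p.1, p.2), p.1)‖ₑ ∂(ν.prod μZ) := by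
      rw [e4, e1, e2]; exact lintegral_congr fun v => by rw [e3]
    rw [h]; exact (hasFiniteIntegral_iff_enorm.1 hI.2).ne
  filter_upwards [ae_lt_top hHG hfin] with q hq hne
  refine ⟨(hf.comp measurable_prodMk_left).aestronglyMeasurable, hasFiniteIntegral_iff_enorm.2 ?_⟩
  have hne' : (margDensity ν μ avg q.1 : ℝ≥0∞) ≠ 0 := ENNReal.coe_ne_zero.2 hne
  rcases ENNReal.mul_lt_top_iff.1 hq with h | h | h
  exacts [h.2, absurd h hne', h ▸ ENNReal.zero_lt_top]

/-- ★ **THE UNGUARDED TWIN, `(avg_* ν ⊗ μZ)`-A.E.** («everywhere the transport is read»): under the same hypotheses the section `f(q, ·)` is integrable against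
`condLaw ν avg q.1` for `((ν.map avg) ⊗ μZ)`-a.e. `q` (`avg_* ν = μ.withDensity h`, `prod_withDensity_left`, `ae_withDensity_iff`). [cite: Balaban1985Averaging, (10) p.19 (bookkeeping)] -/
theorem ae_map_prod_integrable_condLaw_of_integrable_graph (ν : Measure β) [IsFiniteMeasure ν] (μ : Measure α) [SigmaFinite μ]
    {avg : β → α} (havg : Measurable avg) (hac : ν.map avg ≪ μ) {Z : Type*} [MeasurableSpace Z] (μZ : Measure Z) [SFinite μZ]
    {f : (α × Z) × β → ℝ} (hf : Measurable f) (hI : Integrable (fun p : β × Z => f ((avg p.1, p.2), p.1)) (ν.prod μZ)) :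
    ∀ᵐ q ∂((ν.map avg).prod μZ), Integrable (fun y => f (q, y)) (condLaw ν avg q.1) := by
  have hm : Measurable fun q : α × Z => (margDensity ν μ avg q.1 : ℝ≥0∞) :=
    measurable_margDensity.coe_nnreal_ennreal.comp measurable_fst
  rw [← withDensity_margDensity ν μ havg hac, prod_withDensity_left measurable_margDensity.coe_nnreal_ennreal,
    ae_withDensity_iff hm]
  filter_upwards [ae_prod_integrable_condLaw_of_integrable_graph ν μ havg hac μZ hf hI] with q hq hne
  exact hq (by exact_mod_cast hne)

end Generic

/-! ## §2  At 11a's carriers: the restricted averaging of record, product Haar on the V-bonds against product Haar on the image bonds, any s-finite parameter -/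

section AtRecord

variable (F : T4Family) (N : ℕ) [NeZero N]

/-- **11a's RESTRICTED TRANSPORT OF RECORD VANISHES WHERE THE MARGINAL DENSITY DOES** (it carries the factor `h(y′)`), whatever the integrand.
[cite: Balaban1988Convergent, (2.21) p.258 (bookkeeping)] -/
theorem kernelRTOfRecord_eq_zero_of_margDensity_eq_zero (K k : ℕ) [DecidableEq (PBond (F.P K) k)] (sV : Finset (PBond (F.P K) k))
    (sV' : Finset (PBond (F.P K) (k + 1))) (f : (↥sV → SU N) → ℝ) (y' : ↥sV' → SU N)
    (h0 : margDensity (Measure.pi fun _ : ↥sV => (HaarData.haar : Measure (SU N))) (Measure.pi fun _ : ↥sV' => (HaarData.haar : Measure (SU N)))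
      (avgRestrOfRecord F N K k sV sV') y' = 0) :
    kernelRTOfRecord F N K k sV sV' f y' = 0 := by
  show kernelRT _ f y' = 0
  rw [kernelRT_apply, h0, NNReal.coe_zero, zero_mul]

/-- ★★ **GRAPH-PRODUCT INTEGRABILITY ⟹ THE GUARDED `hint` ROW AT 11a's CARRIERS** (finite family): if the restricted averaging of record pushes `Π_{sV} Haar` to a law
absolutely continuous w.r.t. `Π_{sV'} Haar` (`hac` — dag-n11-e's `map_pi_avgRestrOfRecord_absolutelyContinuous…` at the bond sets of record) and every member `g_i` of a
finite family of jointly measurable integrands is integrable along the graph against `Π_{sV} Haar ⊗ μZ`, then for `(Π_{sV'} Haar ⊗ μZ)`-a.e. `q` OFF THE NULL SET OF THE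
MARGINAL DENSITY every section `g_i(q, ·)` is integrable against `condLaw (Π_{sV} Haar) (avgRestrOfRecord …) q.1`. [cite: Balaban1988Convergent, (2.21) p.258 (bookkeeping)] -/
theorem ae_prod_integrable_condLaw_avgRestrOfRecord_of_integrable_graph (K k : ℕ) [DecidableEq (PBond (F.P K) k)] (sV : Finset (PBond (F.P K) k))
    (sV' : Finset (PBond (F.P K) (k + 1)))
    (hac : (Measure.pi fun _ : ↥sV => (HaarData.haar : Measure (SU N))).map (avgRestrOfRecord F N K k sV sV') ≪
      Measure.pi fun _ : ↥sV' => (HaarData.haar : Measure (SU N)))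
    {Z : Type*} [MeasurableSpace Z] (μZ : Measure Z) [SFinite μZ] {I : Type*} (ι : Finset I)
    {g : I → ((↥sV' → SU N) × Z) × (↥sV → SU N) → ℝ} (hgm : ∀ i ∈ ι, Measurable (g i))
    (hI : ∀ i ∈ ι, Integrable (fun p : (↥sV → SU N) × Z => g i ((avgRestrOfRecord F N K k sV sV' p.1, p.2), p.1))
      ((Measure.pi fun _ : ↥sV => (HaarData.haar : Measure (SU N))).prod μZ)) :
    ∀ᵐ q ∂((Measure.pi fun _ : ↥sV' => (HaarData.haar : Measure (SU N))).prod μZ),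
      margDensity (Measure.pi fun _ : ↥sV => (HaarData.haar : Measure (SU N))) (Measure.pi fun _ : ↥sV' => (HaarData.haar : Measure (SU N)))
          (avgRestrOfRecord F N K k sV sV') q.1 ≠ 0 → ∀ i ∈ ι, Integrable (fun y => g i (q, y))
          (condLaw (Measure.pi fun _ : ↥sV => (HaarData.haar : Measure (SU N))) (avgRestrOfRecord F N K k sV sV') q.1) := by
  have h : ∀ i ∈ ι, ∀ᵐ q ∂((Measure.pi fun _ : ↥sV' => (HaarData.haar : Measure (SU N))).prod μZ),
      margDensity (Measure.pi fun _ : ↥sV => (HaarData.haar : Measure (SU N))) (Measure.pi fun _ : ↥sV' => (HaarData.haar : Measure (SU N)))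
          (avgRestrOfRecord F N K k sV sV') q.1 ≠ 0 → Integrable (fun y => g i (q, y))
          (condLaw (Measure.pi fun _ : ↥sV => (HaarData.haar : Measure (SU N))) (avgRestrOfRecord F N K k sV sV') q.1) :=
    fun i hi => ae_prod_integrable_condLaw_of_integrable_graph _ _ (measurable_avgRestrOfRecord (F := F) (N := N) K k sV sV') hac μZ
      (hgm i hi) (hI i hi)
  filter_upwards [(Filter.eventually_all_finset ι).2 h] with q hq hne i hi
  exact hq i hi hne

/-- ★★ **11a's RESTRICTED TRANSPORT OF RECORD IS ADDITIVE OVER FINITE SUMS, A.E., FOR GRAPH-PRODUCT-INTEGRABLE JOINTLY MEASURABLE FAMILIES**: where the marginal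
density vanishes both members vanish; elsewhere p619836's `kernelRTOfRecord_finset_sum_apply` applies with the conditional integrability just supplied.
[cite: Balaban1988Convergent, (2.18) p.257, (2.21) p.258 (bookkeeping)] -/
theorem kernelRTOfRecord_finset_sum_ae_of_integrable_graph (K k : ℕ) [DecidableEq (PBond (F.P K) k)] (sV : Finset (PBond (F.P K) k))
    (sV' : Finset (PBond (F.P K) (k + 1)))
    (hac : (Measure.pi fun _ : ↥sV => (HaarData.haar : Measure (SU N))).map (avgRestrOfRecord F N K k sV sV') ≪
      Measure.pi fun _ : ↥sV' => (HaarData.haar : Measure (SU N)))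
    {Z : Type*} [MeasurableSpace Z] (μZ : Measure Z) [SFinite μZ] {I : Type*} (ι : Finset I)
    {g : I → ((↥sV' → SU N) × Z) × (↥sV → SU N) → ℝ} (hgm : ∀ i ∈ ι, Measurable (g i))
    (hI : ∀ i ∈ ι, Integrable (fun p : (↥sV → SU N) × Z => g i ((avgRestrOfRecord F N K k sV sV' p.1, p.2), p.1))
      ((Measure.pi fun _ : ↥sV => (HaarData.haar : Measure (SU N))).prod μZ)) :
    ∀ᵐ q ∂((Measure.pi fun _ : ↥sV' => (HaarData.haar : Measure (SU N))).prod μZ),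
      kernelRTOfRecord F N K k sV sV' (fun y => ∑ i ∈ ι, g i (q, y)) q.1 = ∑ i ∈ ι, kernelRTOfRecord F N K k sV sV' (fun y => g i (q, y)) q.1 := by
  filter_upwards [ae_prod_integrable_condLaw_avgRestrOfRecord_of_integrable_graph F N K k sV sV' hac μZ ι hgm hI] with q hq
  by_cases h0 : margDensity (Measure.pi fun _ : ↥sV => (HaarData.haar : Measure (SU N))) (Measure.pi fun _ : ↥sV' => (HaarData.haar : Measure (SU N)))
      (avgRestrOfRecord F N K k sV sV') q.1 = 0
  · rw [kernelRTOfRecord_eq_zero_of_margDensity_eq_zero F N K k sV sV' _ q.1 h0]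
    exact (Finset.sum_eq_zero fun i _ => kernelRTOfRecord_eq_zero_of_margDensity_eq_zero F N K k sV sV' _ q.1 h0).symm
  · exact kernelRTOfRecord_finset_sum_apply K k sV sV' ι (fun i y => g i (q, y)) q.1 (hq h0)

end AtRecord

/-! ## §3  p619836's branch-sum junction with `hint` supplied from graph-product integrability -/

section BranchSum

variable {F : T4Family} {N : ℕ} [NeZero N]
variable {V : Type} [NormedAddCommGroup V] [InnerProductSpace ℝ V] [FiniteDimensional ℝ V] [MeasurableSpace V] [BorelSpace V]

/-- ★★★ **THE BRANCH-SUM JUNCTION `_of_integrable_graph`**: dag-n11-d's `…N11TStepBranchSum.tstepOfRecord_comp_glue_ae_eq_sum_genOp` (p619836) with its row `hint`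
(per-summand conditional integrability at `q.1`, product-Haar-a.e. in `q`) REPLACED by joint measurability `hgm` and GRAPH-PRODUCT INTEGRABILITY `hI` of the explicit inside
integrands `(y, z) ↦ ζ_i(ω)·(aOp k sA_i w_i Φ_i)(ω)`, `ω := update (ωOf (avgRestrOfRecord y, z)) k (updateFinset … y, …)`, against `Π_{sV_k} Haar ⊗ Π_{sV'ᶜ} Haar`;
`hG` ∕ `hin` ∕ `hinnerSum` unchanged.  Proof: p616225 `_bondsIn`, p617211's fibre congruence fed `hinnerSum`, then a case split on `margDensity … q.1 = 0` — there both
members vanish (§2), elsewhere §2's guarded row feeds p619836's additivity and one-generation normal form.  `hinnerSum` is where [I] §2's change of variables, its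
Jacobian, the gauge fixing, `ζ`, `aOp` AND [III] Thm 2's re-expansion live — NOT proved here. [cite: Balaban1988Convergent, (2.18) p.257, (2.20)–(2.21) p.258, (3.1) p.264, (3.24)–(3.25) p.270] -/
theorem tstepOfRecord_comp_glue_ae_eq_sum_genOp_of_integrable_graph (ν : Stage7Numerics) (M : ℕ) (w : StepWeightsOfRecord F N ν M)
    (p : B12.RunParams) (g : ℕ → ℝ)
    {k : ℕ} (hkK : k < p.K) [DecidableEq (PBond (F.P p.K) k)] [DecidableEq (PBond (F.P p.K) (k + 1))] (hk : k + 1 ≤ (F.P p.K).m + (F.P p.K).K)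
    (T : SeqOfRecord F ν M g p.K k → Density (F.P p.K) k (SU N)) (s' : SeqOfRecord F ν M g p.K (k + 1))
    (hG : Integrable (fun U => w p g k s' U ((avOfRecord F N p.K k).avg U) * (chiSeqOfRecord F N ν M g p.K k s'.init U * T s'.init U))
      (fieldMeasure (F.P p.K) k (SU N)))
    {Fᵢ : (↥(Set.toFinite (bondsIn k (s'.Ω (k + 1))ᶜ)).toFinset → SU N) ×
        ({c : PBond (F.P p.K) (k + 1) // c ∉ (Set.toFinite (bondsIn (k + 1) (s'.Ω (k + 1))ᶜ)).toFinset} → SU N) → ℝ} (hFm : Measurable Fᵢ)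
    (hin : kernelTransport
        ((Measure.pi fun _ : ↥(Set.toFinite (bondsIn k (s'.Ω (k + 1))ᶜ)).toFinset => (HaarData.haar : Measure (SU N))).prod
          (Measure.pi fun _ : {b : PBond (F.P p.K) k // b ∉ (Set.toFinite (bondsIn k (s'.Ω (k + 1))ᶜ)).toFinset} => (HaarData.haar : Measure (SU N))))
        ((Measure.pi fun _ : ↥(Set.toFinite (bondsIn k (s'.Ω (k + 1))ᶜ)).toFinset => (HaarData.haar : Measure (SU N))).prod
          (Measure.pi fun _ : {c : PBond (F.P p.K) (k + 1) // c ∉ (Set.toFinite (bondsIn (k + 1) (s'.Ω (k + 1))ᶜ)).toFinset} => (HaarData.haar : Measure (SU N))))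
        (fun q => (q.1, fun c : {c : PBond (F.P p.K) (k + 1) // c ∉ (Set.toFinite (bondsIn (k + 1) (s'.Ω (k + 1))ᶜ)).toFinset} =>
          (avOfRecord F N p.K k).avg
            ((MeasurableEquiv.piEquivPiSubtypeProd (fun _ : PBond (F.P p.K) k => SU N)
              (· ∈ (Set.toFinite (bondsIn k (s'.Ω (k + 1))ᶜ)).toFinset)).symm q) c))
        ((fun U => w p g k s' U ((avOfRecord F N p.K k).avg U) * (chiSeqOfRecord F N ν M g p.K k s'.init U * T s'.init U)) ∘
          ⇑(MeasurableEquiv.piEquivPiSubtypeProd (fun _ : PBond (F.P p.K) k => SU N)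
            (· ∈ (Set.toFinite (bondsIn k (s'.Ω (k + 1))ᶜ)).toFinset)).symm)
      =ᵐ[(Measure.pi fun _ : ↥(Set.toFinite (bondsIn k (s'.Ω (k + 1))ᶜ)).toFinset => (HaarData.haar : Measure (SU N))).prod
          (Measure.pi fun _ : {c : PBond (F.P p.K) (k + 1) // c ∉ (Set.toFinite (bondsIn (k + 1) (s'.Ω (k + 1))ᶜ)).toFinset} => (HaarData.haar : Measure (SU N)))] Fᵢ)
    {I : Type*} (ι : Finset I) (W : I → TkWeights F N V p.K) (S : I → ℕ → Set (Site (F.P p.K) 0)) (Φ : I → MultiCfg (F.P p.K) (SU N) V → ℝ)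
    (ωOf : (↥(Set.toFinite (bondsIn (k + 1) (s'.Ω (k + 1))ᶜ)).toFinset → SU N) ×
        ({c : PBond (F.P p.K) (k + 1) // c ∉ (Set.toFinite (bondsIn (k + 1) (s'.Ω (k + 1))ᶜ)).toFinset} → SU N) → MultiCfg (F.P p.K) (SU N) V)
    (hω : ∀ q, (fun b : ↥(Set.toFinite (bondsIn (k + 1) (s'.Ω (k + 1))ᶜ)).toFinset => ((ωOf q) (k + 1)).1 (b : PBond (F.P p.K) (k + 1))) = q.1)
    (hgm : ∀ i ∈ ι, Measurable fun x :
        ((↥(Set.toFinite (bondsIn (k + 1) (s'.Ω (k + 1))ᶜ)).toFinset → SU N) ×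
            ({c : PBond (F.P p.K) (k + 1) // c ∉ (Set.toFinite (bondsIn (k + 1) (s'.Ω (k + 1))ᶜ)).toFinset} → SU N)) ×
          (↥(Set.toFinite (bondsIn k (s'.Ω (k + 1))ᶜ)).toFinset → SU N) =>
      zetaOp (genDataOfRecord F N V ν M g p.K (W i) s' (S i) k).ζ
        (aOp k (genDataOfRecord F N V ν M g p.K (W i) s' (S i) k).sA (genDataOfRecord F N V ν M g p.K (W i) s' (S i) k).w (Φ i))
        (Function.update (ωOf x.1) k
          (Function.updateFinset ((ωOf x.1) k).1 (Set.toFinite (bondsIn k (s'.Ω (k + 1))ᶜ)).toFinset x.2, ((ωOf x.1) k).2)))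
    (hI : ∀ i ∈ ι, Integrable (fun y :
        (↥(Set.toFinite (bondsIn k (s'.Ω (k + 1))ᶜ)).toFinset → SU N) ×
          ({c : PBond (F.P p.K) (k + 1) // c ∉ (Set.toFinite (bondsIn (k + 1) (s'.Ω (k + 1))ᶜ)).toFinset} → SU N) =>
      zetaOp (genDataOfRecord F N V ν M g p.K (W i) s' (S i) k).ζ
        (aOp k (genDataOfRecord F N V ν M g p.K (W i) s' (S i) k).sA (genDataOfRecord F N V ν M g p.K (W i) s' (S i) k).w (Φ i))
        (Function.update (ωOf (avgRestrOfRecord F N p.K k (Set.toFinite (bondsIn k (s'.Ω (k + 1))ᶜ)).toFinset (Set.toFinite (bondsIn (k + 1) (s'.Ω (k + 1))ᶜ)).toFinset y.1, y.2)) k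
          (Function.updateFinset
            ((ωOf (avgRestrOfRecord F N p.K k (Set.toFinite (bondsIn k (s'.Ω (k + 1))ᶜ)).toFinset (Set.toFinite (bondsIn (k + 1) (s'.Ω (k + 1))ᶜ)).toFinset y.1, y.2)) k).1
            (Set.toFinite (bondsIn k (s'.Ω (k + 1))ᶜ)).toFinset y.1,
            ((ωOf (avgRestrOfRecord F N p.K k (Set.toFinite (bondsIn k (s'.Ω (k + 1))ᶜ)).toFinset (Set.toFinite (bondsIn (k + 1) (s'.Ω (k + 1))ᶜ)).toFinset y.1, y.2)) k).2)))
      ((Measure.pi fun _ : ↥(Set.toFinite (bondsIn k (s'.Ω (k + 1))ᶜ)).toFinset => (HaarData.haar : Measure (SU N))).prod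
        (Measure.pi fun _ : {c : PBond (F.P p.K) (k + 1) // c ∉ (Set.toFinite (bondsIn (k + 1) (s'.Ω (k + 1))ᶜ)).toFinset} => (HaarData.haar : Measure (SU N)))))
    (hinnerSum : ∀ᵐ q ∂((Measure.pi fun _ : ↥(Set.toFinite (bondsIn (k + 1) (s'.Ω (k + 1))ᶜ)).toFinset => (HaarData.haar : Measure (SU N))).prod
          (Measure.pi fun _ : {c : PBond (F.P p.K) (k + 1) // c ∉ (Set.toFinite (bondsIn (k + 1) (s'.Ω (k + 1))ᶜ)).toFinset} => (HaarData.haar : Measure (SU N)))),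
      ∀ y : ↥(Set.toFinite (bondsIn k (s'.Ω (k + 1))ᶜ)).toFinset → SU N,
        avgRestrOfRecord F N p.K k (Set.toFinite (bondsIn k (s'.Ω (k + 1))ᶜ)).toFinset (Set.toFinite (bondsIn (k + 1) (s'.Ω (k + 1))ᶜ)).toFinset y = q.1 →
        Fᵢ (y, q.2) =
          ∑ i ∈ ι, zetaOp (genDataOfRecord F N V ν M g p.K (W i) s' (S i) k).ζ
            (aOp k (genDataOfRecord F N V ν M g p.K (W i) s' (S i) k).sA (genDataOfRecord F N V ν M g p.K (W i) s' (S i) k).w (Φ i))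
            (Function.update (ωOf q) k
              (Function.updateFinset ((ωOf q) k).1 (Set.toFinite (bondsIn k (s'.Ω (k + 1))ᶜ)).toFinset y, ((ωOf q) k).2))) :
    (tstepOfRecord F N ν M w p g k T s') ∘
        ⇑(MeasurableEquiv.piEquivPiSubtypeProd (fun _ : PBond (F.P p.K) (k + 1) => SU N) (· ∈ (Set.toFinite (bondsIn (k + 1) (s'.Ω (k + 1))ᶜ)).toFinset)).symm
      =ᵐ[(Measure.pi fun _ : ↥(Set.toFinite (bondsIn (k + 1) (s'.Ω (k + 1))ᶜ)).toFinset => (HaarData.haar : Measure (SU N))).prod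
          (Measure.pi fun _ : {c : PBond (F.P p.K) (k + 1) // c ∉ (Set.toFinite (bondsIn (k + 1) (s'.Ω (k + 1))ᶜ)).toFinset} => (HaarData.haar : Measure (SU N)))]
        fun q => ∑ i ∈ ι, genOp k (genDataOfRecord F N V ν M g p.K (W i) s' (S i) k) (Φ i) (ωOf q) := by
  have hac := map_pi_avgRestrOfRecord_absolutelyContinuous_Omega F N p.K s' k hk
  have h5 := tstepOfRecord_comp_glue_ae_eq_kernelRTOfRecord_bondsIn ν M w p g hkK hk T s' (toFine_mem_compl_Omega_iff s' hk) hG hFm hin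
  have hfib := kernelRTOfRecord_congr_of_fibre_ae_prod (F := F) (N := N) p.K k (Set.toFinite (bondsIn k (s'.Ω (k + 1))ᶜ)).toFinset
    (Set.toFinite (bondsIn (k + 1) (s'.Ω (k + 1))ᶜ)).toFinset
    (Measure.pi fun _ : {c : PBond (F.P p.K) (k + 1) // c ∉ (Set.toFinite (bondsIn (k + 1) (s'.Ω (k + 1))ᶜ)).toFinset} => (HaarData.haar : Measure (SU N)))
  have hint := ae_prod_integrable_condLaw_avgRestrOfRecord_of_integrable_graph F N p.K k
    (Set.toFinite (bondsIn k (s'.Ω (k + 1))ᶜ)).toFinset (Set.toFinite (bondsIn (k + 1) (s'.Ω (k + 1))ᶜ)).toFinset hac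
    (Measure.pi fun _ : {c : PBond (F.P p.K) (k + 1) // c ∉ (Set.toFinite (bondsIn (k + 1) (s'.Ω (k + 1))ᶜ)).toFinset} => (HaarData.haar : Measure (SU N))) ι hgm hI
  filter_upwards [h5, hfib, hint, hinnerSum] with q hq hfq hintq hiq
  rw [hq, hfq _ _ hiq]
  by_cases h0 : margDensity (Measure.pi fun _ : ↥(Set.toFinite (bondsIn k (s'.Ω (k + 1))ᶜ)).toFinset => (HaarData.haar : Measure (SU N)))
      (Measure.pi fun _ : ↥(Set.toFinite (bondsIn (k + 1) (s'.Ω (k + 1))ᶜ)).toFinset => (HaarData.haar : Measure (SU N)))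
      (avgRestrOfRecord F N p.K k (Set.toFinite (bondsIn k (s'.Ω (k + 1))ᶜ)).toFinset (Set.toFinite (bondsIn (k + 1) (s'.Ω (k + 1))ᶜ)).toFinset) q.1 = 0
  · rw [kernelRTOfRecord_eq_zero_of_margDensity_eq_zero F N p.K k _ _ _ q.1 h0, eq_comm]
    refine Finset.sum_eq_zero fun i _ => ?_
    rw [genOp_genDataOfRecord_eq_kernelRTOfRecord_of_pinned ν M g p.K (W i) s' (S i) (Φ i) ωOf (fun q => q.1) hω q]
    exact kernelRTOfRecord_eq_zero_of_margDensity_eq_zero F N p.K k _ _ _ q.1 h0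
  · rw [kernelRTOfRecord_finset_sum_apply p.K k _ _ ι _ q.1 (hintq h0)]
    exact Finset.sum_congr rfl fun i _ =>
      (genOp_genDataOfRecord_eq_kernelRTOfRecord_of_pinned ν M g p.K (W i) s' (S i) (Φ i) ωOf (fun q => q.1) hω q).symm

end BranchSum

/-! ## §4  The identity of (O3′) on the nose with `hint` supplied from graph-product integrability -/

section OnTheNose

variable {F : T4Family} {N : ℕ} [NeZero N]
variable {V : Type} [NormedAddCommGroup V] [InnerProductSpace ℝ V] [FiniteDimensional ℝ V] [MeasurableSpace V] [BorelSpace V]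

/-- ★★★ **THE IDENTITY OF (O3′) ON THE NOSE, MODULO THE CHARTED INNER SUM, `_of_integrable_graph`**: dag-n11-d's `slotsTOfRecord_succ_ae_eq_TkOfRecord_succ_of_innerSum`
(p619836 §3) with its row `hint` REPLACED by joint measurability `hgm` and GRAPH-PRODUCT INTEGRABILITY `hI` of the explicit inside integrands of the branches
`S ∈ admSOfRecord (k+1) s′` at the canonical family `baseCfg (k+1) (e_α q)`: `slotsTOfRecord … (k+1) s′ =ᵐ[dV′] TkOfRecord F N V ν τ.M g K W (k+1) s′ Φ` modulo `hG` ∕ `hin` ∕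
`hinnerSum` (unchanged, DISPLAYED — `hinnerSum` carries ALL the mathematics of [I] §2 ∕ [III] §3 ∕ Thm 2).  §3 at the canonical data, then p619836's `slotsTOfRecord_succ` step,
`TkOfRecord_succ_eq_sum_genOp`, `baseCfg_succ_comp_glue_pinned` and un-presentation `ae_eq_of_comp_glue_ae_eq` BY NAME.
[cite: Balaban1988Convergent, (2.18) p.257, (2.20)–(2.21) p.258, (2.23) p.258, (3.1) p.264, (3.24)–(3.25) p.270, §3 p.279] -/
theorem slotsTOfRecord_succ_ae_eq_TkOfRecord_succ_of_innerSum_of_integrable_graph (ν : Stage7Numerics) (τ : TowerNumerics) (E : B12.RunParams → ℝ)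
    (w : StepWeightsOfRecord F N ν τ.M) (ppSel : PpSelOfRecord F ν τ.M) (p : B12.RunParams) (g : ℕ → ℝ) {k : ℕ} (hkK : k < p.K)
    {hdec : DecidableEq (PBond (F.P p.K) k)} {hdec' : DecidableEq (PBond (F.P p.K) (k + 1))} (hk : k + 1 ≤ (F.P p.K).m + (F.P p.K).K)
    (s' : SeqOfRecord F ν τ.M g p.K (k + 1)) (W : TkWeights F N V p.K)
    (Φ : SFluct (F.P p.K) V → B15DeterminingSets.MSField (F.P p.K) (SU N) → ℝ)
    (hG : Integrable (fun U => w p g k s' U ((avOfRecord F N p.K k).avg U) *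
      (chiSeqOfRecord F N ν τ.M g p.K k s'.init U * slotsOfRecord F N ν τ E w ppSel p g k s'.init U)) (fieldMeasure (F.P p.K) k (SU N)))
    {Fᵢ : (↥(Set.toFinite (bondsIn k (s'.Ω (k + 1))ᶜ)).toFinset → SU N) ×
        ({c : PBond (F.P p.K) (k + 1) // c ∉ (Set.toFinite (bondsIn (k + 1) (s'.Ω (k + 1))ᶜ)).toFinset} → SU N) → ℝ} (hFm : Measurable Fᵢ)
    (hin : kernelTransport
        ((Measure.pi fun _ : ↥(Set.toFinite (bondsIn k (s'.Ω (k + 1))ᶜ)).toFinset => (HaarData.haar : Measure (SU N))).prod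
          (Measure.pi fun _ : {b : PBond (F.P p.K) k // b ∉ (Set.toFinite (bondsIn k (s'.Ω (k + 1))ᶜ)).toFinset} => (HaarData.haar : Measure (SU N))))
        ((Measure.pi fun _ : ↥(Set.toFinite (bondsIn k (s'.Ω (k + 1))ᶜ)).toFinset => (HaarData.haar : Measure (SU N))).prod
          (Measure.pi fun _ : {c : PBond (F.P p.K) (k + 1) // c ∉ (Set.toFinite (bondsIn (k + 1) (s'.Ω (k + 1))ᶜ)).toFinset} => (HaarData.haar : Measure (SU N))))
        (fun q => (q.1, fun c : {c : PBond (F.P p.K) (k + 1) // c ∉ (Set.toFinite (bondsIn (k + 1) (s'.Ω (k + 1))ᶜ)).toFinset} =>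
          (avOfRecord F N p.K k).avg
            ((MeasurableEquiv.piEquivPiSubtypeProd (fun _ : PBond (F.P p.K) k => SU N)
              (· ∈ (Set.toFinite (bondsIn k (s'.Ω (k + 1))ᶜ)).toFinset)).symm q) c))
        ((fun U => w p g k s' U ((avOfRecord F N p.K k).avg U) *
            (chiSeqOfRecord F N ν τ.M g p.K k s'.init U * slotsOfRecord F N ν τ E w ppSel p g k s'.init U)) ∘
          ⇑(MeasurableEquiv.piEquivPiSubtypeProd (fun _ : PBond (F.P p.K) k => SU N)
            (· ∈ (Set.toFinite (bondsIn k (s'.Ω (k + 1))ᶜ)).toFinset)).symm)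
      =ᵐ[(Measure.pi fun _ : ↥(Set.toFinite (bondsIn k (s'.Ω (k + 1))ᶜ)).toFinset => (HaarData.haar : Measure (SU N))).prod
          (Measure.pi fun _ : {c : PBond (F.P p.K) (k + 1) // c ∉ (Set.toFinite (bondsIn (k + 1) (s'.Ω (k + 1))ᶜ)).toFinset} => (HaarData.haar : Measure (SU N)))] Fᵢ)
    (hgm : ∀ S ∈ admSOfRecord F ν τ.M g p.K (k + 1) s', Measurable fun x :
        ((↥(Set.toFinite (bondsIn (k + 1) (s'.Ω (k + 1))ᶜ)).toFinset → SU N) ×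
            ({c : PBond (F.P p.K) (k + 1) // c ∉ (Set.toFinite (bondsIn (k + 1) (s'.Ω (k + 1))ᶜ)).toFinset} → SU N)) ×
          (↥(Set.toFinite (bondsIn k (s'.Ω (k + 1))ᶜ)).toFinset → SU N) =>
      zetaOp (genDataOfRecord F N V ν τ.M g p.K W s' S k).ζ
        (aOp k (genDataOfRecord F N V ν τ.M g p.K W s' S k).sA (genDataOfRecord F N V ν τ.M g p.K W s' S k).w
          (tkBranchOfRecord F N V ν τ.M g p.K W s' S k (fun ω => Φ (S, fun j => (ω j).2) (fun j => (ω j).1))))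
        (Function.update (baseCfg (k + 1) ((MeasurableEquiv.piEquivPiSubtypeProd (fun _ : PBond (F.P p.K) (k + 1) => SU N)
                (· ∈ (Set.toFinite (bondsIn (k + 1) (s'.Ω (k + 1))ᶜ)).toFinset)).symm x.1)) k
          (Function.updateFinset ((baseCfg (V := V) (k + 1) ((MeasurableEquiv.piEquivPiSubtypeProd (fun _ : PBond (F.P p.K) (k + 1) => SU N)
                (· ∈ (Set.toFinite (bondsIn (k + 1) (s'.Ω (k + 1))ᶜ)).toFinset)).symm x.1)) k).1 (Set.toFinite (bondsIn k (s'.Ω (k + 1))ᶜ)).toFinset x.2,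
            ((baseCfg (V := V) (k + 1) ((MeasurableEquiv.piEquivPiSubtypeProd (fun _ : PBond (F.P p.K) (k + 1) => SU N)
                (· ∈ (Set.toFinite (bondsIn (k + 1) (s'.Ω (k + 1))ᶜ)).toFinset)).symm x.1)) k).2)))
    (hI : ∀ S ∈ admSOfRecord F ν τ.M g p.K (k + 1) s', Integrable (fun y :
        (↥(Set.toFinite (bondsIn k (s'.Ω (k + 1))ᶜ)).toFinset → SU N) ×
          ({c : PBond (F.P p.K) (k + 1) // c ∉ (Set.toFinite (bondsIn (k + 1) (s'.Ω (k + 1))ᶜ)).toFinset} → SU N) =>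
      zetaOp (genDataOfRecord F N V ν τ.M g p.K W s' S k).ζ
        (aOp k (genDataOfRecord F N V ν τ.M g p.K W s' S k).sA (genDataOfRecord F N V ν τ.M g p.K W s' S k).w
          (tkBranchOfRecord F N V ν τ.M g p.K W s' S k (fun ω => Φ (S, fun j => (ω j).2) (fun j => (ω j).1))))
        (Function.update (baseCfg (k + 1) ((MeasurableEquiv.piEquivPiSubtypeProd (fun _ : PBond (F.P p.K) (k + 1) => SU N)
                (· ∈ (Set.toFinite (bondsIn (k + 1) (s'.Ω (k + 1))ᶜ)).toFinset)).symm (avgRestrOfRecord F N p.K k (Set.toFinite (bondsIn k (s'.Ω (k + 1))ᶜ)).toFinset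
                  (Set.toFinite (bondsIn (k + 1) (s'.Ω (k + 1))ᶜ)).toFinset y.1, y.2))) k
          (Function.updateFinset ((baseCfg (V := V) (k + 1) ((MeasurableEquiv.piEquivPiSubtypeProd (fun _ : PBond (F.P p.K) (k + 1) => SU N)
                (· ∈ (Set.toFinite (bondsIn (k + 1) (s'.Ω (k + 1))ᶜ)).toFinset)).symm (avgRestrOfRecord F N p.K k (Set.toFinite (bondsIn k (s'.Ω (k + 1))ᶜ)).toFinset
                  (Set.toFinite (bondsIn (k + 1) (s'.Ω (k + 1))ᶜ)).toFinset y.1, y.2))) k).1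
            (Set.toFinite (bondsIn k (s'.Ω (k + 1))ᶜ)).toFinset y.1,
            ((baseCfg (V := V) (k + 1) ((MeasurableEquiv.piEquivPiSubtypeProd (fun _ : PBond (F.P p.K) (k + 1) => SU N)
                (· ∈ (Set.toFinite (bondsIn (k + 1) (s'.Ω (k + 1))ᶜ)).toFinset)).symm (avgRestrOfRecord F N p.K k (Set.toFinite (bondsIn k (s'.Ω (k + 1))ᶜ)).toFinset
                  (Set.toFinite (bondsIn (k + 1) (s'.Ω (k + 1))ᶜ)).toFinset y.1, y.2))) k).2)))
      ((Measure.pi fun _ : ↥(Set.toFinite (bondsIn k (s'.Ω (k + 1))ᶜ)).toFinset => (HaarData.haar : Measure (SU N))).prod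
        (Measure.pi fun _ : {c : PBond (F.P p.K) (k + 1) // c ∉ (Set.toFinite (bondsIn (k + 1) (s'.Ω (k + 1))ᶜ)).toFinset} => (HaarData.haar : Measure (SU N)))))
    (hinnerSum : ∀ᵐ q ∂((Measure.pi fun _ : ↥(Set.toFinite (bondsIn (k + 1) (s'.Ω (k + 1))ᶜ)).toFinset => (HaarData.haar : Measure (SU N))).prod
          (Measure.pi fun _ : {c : PBond (F.P p.K) (k + 1) // c ∉ (Set.toFinite (bondsIn (k + 1) (s'.Ω (k + 1))ᶜ)).toFinset} => (HaarData.haar : Measure (SU N)))),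
      ∀ y : ↥(Set.toFinite (bondsIn k (s'.Ω (k + 1))ᶜ)).toFinset → SU N,
        avgRestrOfRecord F N p.K k (Set.toFinite (bondsIn k (s'.Ω (k + 1))ᶜ)).toFinset (Set.toFinite (bondsIn (k + 1) (s'.Ω (k + 1))ᶜ)).toFinset y = q.1 →
        Fᵢ (y, q.2) =
          ∑ S ∈ admSOfRecord F ν τ.M g p.K (k + 1) s', zetaOp (genDataOfRecord F N V ν τ.M g p.K W s' S k).ζ
            (aOp k (genDataOfRecord F N V ν τ.M g p.K W s' S k).sA (genDataOfRecord F N V ν τ.M g p.K W s' S k).w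
              (tkBranchOfRecord F N V ν τ.M g p.K W s' S k (fun ω => Φ (S, fun j => (ω j).2) (fun j => (ω j).1))))
            (Function.update (baseCfg (k + 1) ((MeasurableEquiv.piEquivPiSubtypeProd (fun _ : PBond (F.P p.K) (k + 1) => SU N)
                (· ∈ (Set.toFinite (bondsIn (k + 1) (s'.Ω (k + 1))ᶜ)).toFinset)).symm q)) k
              (Function.updateFinset ((baseCfg (V := V) (k + 1) ((MeasurableEquiv.piEquivPiSubtypeProd (fun _ : PBond (F.P p.K) (k + 1) => SU N)
                (· ∈ (Set.toFinite (bondsIn (k + 1) (s'.Ω (k + 1))ᶜ)).toFinset)).symm q)) k).1 (Set.toFinite (bondsIn k (s'.Ω (k + 1))ᶜ)).toFinset y,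
                ((baseCfg (V := V) (k + 1) ((MeasurableEquiv.piEquivPiSubtypeProd (fun _ : PBond (F.P p.K) (k + 1) => SU N)
                  (· ∈ (Set.toFinite (bondsIn (k + 1) (s'.Ω (k + 1))ᶜ)).toFinset)).symm q)) k).2))) :
    slotsTOfRecord F N ν τ E w ppSel p g (k + 1) s' =ᵐ[fieldMeasure (F.P p.K) (k + 1) (SU N)] TkOfRecord F N V ν τ.M g p.K W (k + 1) s' Φ :=
  ae_eq_of_comp_glue_ae_eq p.K (k + 1) _ (by
    have h := tstepOfRecord_comp_glue_ae_eq_sum_genOp_of_integrable_graph ν τ.M w p g hkK hk (slotsOfRecord F N ν τ E w ppSel p g k) s' hG hFm hin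
      (admSOfRecord F ν τ.M g p.K (k + 1) s') (fun _ => W) (fun S => S)
      (fun S => tkBranchOfRecord F N V ν τ.M g p.K W s' S k (fun ω => Φ (S, fun j => (ω j).2) (fun j => (ω j).1)))
      (fun q => baseCfg (k + 1) ((MeasurableEquiv.piEquivPiSubtypeProd (fun _ : PBond (F.P p.K) (k + 1) => SU N)
        (· ∈ (Set.toFinite (bondsIn (k + 1) (s'.Ω (k + 1))ᶜ)).toFinset)).symm q))
      (baseCfg_succ_comp_glue_pinned p.K k _) hgm hI hinnerSum
    rw [slotsTOfRecord_succ]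
    filter_upwards [h] with q hq
    rw [hq, Function.comp_apply, TkOfRecord_succ_eq_sum_genOp ν τ.M g p.K W (hdec := hdec) s' Φ])

end OnTheNose

end Summit.QuantumFields.YangMills.Theorems.BalabanUVNodesN11KernelRTSectionIntegrable

end
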